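import Literature.AlgebraicGeometry.Resolution.Hironaka1964LocalCompletionRing
import Literature.AlgebraicGeometry.Resolution.Hironaka1964LocalAffineChart
import Literature.AlgebraicGeometry.Resolution.SpreadShapeData
import Literature.AlgebraicGeometry.Resolution.CompletedPullbackRegular
import Literature.AlgebraicGeometry.Resolution.RegularLocalRingsFlatDescent
import Literature.AlgebraicGeometry.Resolution.MarkedIdealsLemmas
import Literature.AlgebraicGeometry.Resolution.ChowLemmaAffineBase
import Mathlib.AlgebraicGeometry.Morphisms.Flat
import HarnessLib

/-!
# `Hironaka1964_local` reduces to the `g`-adically complete principal affine case (Temkin's local step, first half)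

Topic: `Literature/AlgebraicGeometry/Resolution`. Companion of `Hironaka1964LocalAffineChart.lean`
and `Hironaka1964LocalCompletionRing.lean` (proofs only: no new notions, no new named facts).
After `Hironaka1964LocalAffineChart.lean` the named fact `Hironaka1964_local` (Hironaka 1964,
Main Theorem I, over local quasi-excellent rings of residue characteristic zero, as read by
Temkin 2008) is reduced to the principal affine case

  (A) for a quasi-excellent domain `A ⊇ ℚ`, `g ∈ A` with `A_𝔭` regular for all `𝔭 ∌ g` and
      `A/gA` of finite type over a field, every blow-up `Y → Spec A` centred in `V(g)` admits
      a desingularization.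

Temkin's local step (proof of Thm. 3.4.1, p. 18) treats the affine formal scheme
`𝔛₀ = Spf Â` — the `g`-adic completion — and its formal blow-up: "By proposition 3.2.3, `𝔛₀`
is isomorphic to a formal `K°`-scheme of finite type, hence `𝔛₀` is `𝒪`-algebraizable by
proposition 3.3.1 … The formal scheme `𝔛'₀` is obtained from `𝔛₀` by blowing up an open ideal …
hence `𝔍` is the completion of a `T`-supported ideal … `f̂₀` is the completion of `f` by lemma
2.1.8", with the comparison lemmas of §3.1 (Lemma 3.1.4: "Since `A` is quasi-excellent, the
homomorphism `A → Â` is regular by [EGA IV]"; Cor. 3.1.5). This file proves, sorry-free and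
without formal schemes, the passage from `A` to `Â`: working with the honest scheme
`Ŷ = Y ×_{Spec A} Spec Â` (a blow-up of `Spec Â` centred in `V(ĝ)`, flat base change) instead
of the formal completion, it reduces (A) to

  (Â) **the complete principal affine case**: for a Noetherian ring `A`, complete for the
      `g`-adic topology, reduced, containing `ℚ`, with `A_𝔭` regular for all `𝔭 ∌ g` and `A/gA`
      of finite type over a field, every blow-up `Y → Spec A` centred in `V(g)` admits a
      desingularization

— the input of the algebraization half of the local step (Prop. 3.2.3, Prop. 3.3.1 = Elkik,
resolution of varieties in characteristic zero) — together with

  (REG) for every quasi-excellent ring `A` and ideal `I`, `A → Â_I` is a regular homomorphism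
      (EGA IV₂ 7.8.3 (v), the property Temkin invokes in Lemma 3.1.4).

* `exists_ringEquiv_sections_pullback_fst` — the sections of `Y ×_A Spec E` over `φ⁻¹(W)` for an
  affine open `W = Spec B` of the `A`-scheme `Y` (`fromSpec_comp_eq_specMap` of
  `ChowLemmaAffineBase.lean`): `Γ(Y ×_A E, φ⁻¹W) ≅ B ⊗_A E` with `φ^* ↦ (b ↦ b ⊗ 1)` (through the
  chart `specTensorChart` of `CompletedPullbackRegular.lean`).
* `affine_of_complete` — **(REG) ∧ (Â) ⟹ (A)**. For `A, g, Y = Bl_Q(Spec A)` as in (A): `Â` is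
  Noetherian (Stacks 0316), `ĝ`-adically complete, reduced and rig-regular (`A → Â` regular:
  `IsRegularHom.isReduced`, `IsRegularHom.isRegularLocalRing_localization_iff`), `Â/ĝÂ ≅ A/gA`
  is of finite type over the field; `Ŷ = Y ×_A Â → Spec Â` is the blow-up along `QÂ`
  (`IsBlowup.pullback_snd_of_flat`), centred in `V(ĝ)`; by (Â) it has a desingularization
  `Bl_Ĵ(Ŷ) → Ŷ`. The singular locus of `Ŷ` lies over `V(ĝ)` (`Spec Â ∖ V(ĝ)` is regular and the
  blow-up is an isomorphism there), so `(gᴺ) ⊆ Ĵ` for some `N`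
  (`exists_pow_succ_le_of_support_subset`); on the affine pieces
  `Γ(Ŷ, φ⁻¹W) ≅ Γ(Y, W) ⊗_A Â ≡ Γ(Y, W) (mod gᴺ)` (`exists_sub_tmul_one_mem_map_pow`), hence
  `Ĵ = J·𝒪_Ŷ` for `J = φ_*Ĵ ∩ 𝒪_Y` (`Ideal.map_comap_eq_of_forall_sub_mem`), and `Supp J ⊆ Y_sing`
  because regularity ascends along `φ` at the points over `V(g)`
  (`isRegularLocalRing_localization_of_forall_sub_mem`, Matsumura 23.7 (ii)). Finally `Bl_J(Y)`
  is regular: `Bl_J(Y) ×_Y Ŷ = Bl_Ĵ(Ŷ)` (flat base change, `IsPullback.of_bot'`, uniqueness of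
  blow-ups) is regular, every point of `Bl_J(Y)` over `V(g)` lies under a point of it
  (`A/g ≅ Â/ĝ`) and regularity descends along the flat projection (Matsumura 23.7 (i),
  `IsRegularLocalRing.of_flat_ringHom`), while off `V(g)` the maps `Bl_J(Y) → Y → Spec A` are
  local isomorphisms onto the regular `Spec A ∖ V(g)`.
* `hironaka1964_local_of_complete` — **(REG) ∧ (Â) ⟹ `Hironaka1964_local`**
  (with `hironaka1964_local_of_affine`).

No named fact is introduced: (REG) and (Â) appear only as hypotheses.

## Sources

* M. Temkin, *Desingularization of quasi-excellent schemes in characteristic zero*, Adv. Math.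
  219 (2008) 488–522 = arXiv:math/0703678 (arXiv pagination): Lemma 2.1.7–2.1.8 (p. 7–8),
  Lemma 3.1.4 and Cor. 3.1.5 (p. 15), Thm. 3.4.1 and its proof (p. 18), Thm. 3.4.3 (p. 19).
  [Temkin2008]
* A. Grothendieck, EGA IV₂, (7.8.3) (v). [EGAIV2]
* H. Matsumura, *Commutative Ring Theory*, CUP 1986, Thm. 23.7. [Matsumura1987]
* H. Hironaka, *Resolution of singularities of an algebraic variety over a field of
  characteristic zero I*, Ann. of Math. 79 (1964) 109–203, Main Theorem I. [Hironaka1964]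
-/

noncomputable section

open CategoryTheory CategoryTheory.Limits AlgebraicGeometry TopologicalSpace IsLocalRing TensorProduct

namespace Literature.AlgebraicGeometry.Resolution

universe u

/-- **Sections of `Y ×_{Spec A} Spec E` over the preimage of an affine open `W ⊆ Y` are
`Γ(Y, W) ⊗_A E`**, compatibly with `φ^* : Γ(Y, W) → Γ(Y ×_A E, φ⁻¹W)` and `b ↦ b ⊗ 1` (the chart
`specTensorChart`, an open immersion with range `φ⁻¹(W)`). [folklore] -/
theorem exists_ringEquiv_sections_pullback_fst {A : Type u} [CommRing A] (E : Type u) [CommRing E]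
    [Algebra A E] {Y : Scheme.{u}} (q : Y ⟶ Spec (.of A)) {W : Y.Opens} (hW : IsAffineOpen W)
    [Algebra A Γ(Y, W)]
    (hi : hW.fromSpec ≫ q = Spec.map (CommRingCat.ofHom (algebraMap A Γ(Y, W)))) :
    ∃ e : Γ(pullback q (specOfAlgebra A E), pullback.fst q (specOfAlgebra A E) ⁻¹ᵁ W) ≃+*
        Γ(Y, W) ⊗[A] E,
      ∀ y : Γ(Y, W), e (pullback.fst q (specOfAlgebra A E) |>.app W y) = y ⊗ₜ[A] (1 : E) := by
  set T : Type u := Γ(Y, W) ⊗[A] E with hT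
  set c := specTensorChart E q hW.fromSpec hi with hc
  set φ := pullback.fst q (specOfAlgebra A E) with hφ
  have hrange : c.opensRange = φ ⁻¹ᵁ W := by
    apply TopologicalSpace.Opens.ext
    rw [Scheme.Hom.coe_opensRange, hc, range_specTensorChart, IsAffineOpen.range_fromSpec]
    rfl
  have hle : (⊤ : (Spec (CommRingCat.of T)).Opens) ≤ c ⁻¹ᵁ (φ ⁻¹ᵁ W) := by
    rw [← hrange, Scheme.Hom.preimage_opensRange]
  let Φ₀ : Γ(pullback q (specOfAlgebra A E), φ ⁻¹ᵁ W) ⟶ Γ(Spec (CommRingCat.of T), ⊤) :=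
    c.appLE (φ ⁻¹ᵁ W) ⊤ hle
  have himg : c ''ᵁ ⊤ = φ ⁻¹ᵁ W := by rw [Scheme.Hom.image_top_eq_opensRange, hrange]
  haveI hΦ₀ : IsIso Φ₀ := by
    have : Φ₀ = (pullback q (specOfAlgebra A E)).presheaf.map (eqToHom himg).op ≫ (c.appIso ⊤).hom := by
      rw [Scheme.Hom.appIso_hom', Scheme.Hom.map_appLE]
    rw [this]
    infer_instance
  have key : φ.app W ≫ Φ₀ = CommRingCat.ofHom (Algebra.TensorProduct.includeLeftRingHom
      (R := A) (A := Γ(Y, W)) (B := E)) ≫ (Scheme.ΓSpecIso (.of T)).inv := by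
    have h1 : φ.app W ≫ Φ₀ = (c ≫ φ).appLE W ⊤ hle := (Scheme.Hom.comp_appLE c φ W ⊤ hle).symm
    have hcφ : c ≫ φ = Spec.map (CommRingCat.ofHom (Algebra.TensorProduct.includeLeftRingHom
        (R := A) (A := Γ(Y, W)) (B := E))) ≫ hW.fromSpec := specTensorChart_fst E q hW.fromSpec hi
    have h2 : ∀ {f g : Spec (CommRingCat.of T) ⟶ Y} (h : f = g) (e : ⊤ ≤ f ⁻¹ᵁ W),
        f.appLE W ⊤ e = g.appLE W ⊤ (h ▸ e) := by
      intro f g h e; subst h; rfl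
    rw [h1, h2 hcφ, Scheme.Hom.comp_appLE, IsAffineOpen.fromSpec_app_self, Category.assoc,
      Scheme.Hom.map_appLE]
    have h3 : ∀ (e : (⊤ : (Spec (CommRingCat.of T)).Opens) ≤ (Spec.map (CommRingCat.ofHom
        (Algebra.TensorProduct.includeLeftRingHom (R := A) (A := Γ(Y, W)) (B := E)))) ⁻¹ᵁ ⊤),
        (Spec.map (CommRingCat.ofHom (Algebra.TensorProduct.includeLeftRingHom (R := A)
          (A := Γ(Y, W)) (B := E)))).appLE ⊤ ⊤ e = (Spec.map (CommRingCat.ofHom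
          (Algebra.TensorProduct.includeLeftRingHom (R := A) (A := Γ(Y, W)) (B := E)))).appTop := by
      intro e
      rw [Scheme.Hom.appLE]
      have : (homOfLE e).op = 𝟙 _ := Subsingleton.elim _ _
      rw [this]
      erw [CategoryTheory.Functor.map_id, Category.comp_id]
    rw [h3, ← Scheme.ΓSpecIso_inv_naturality]
  let e : Γ(pullback q (specOfAlgebra A E), φ ⁻¹ᵁ W) ≃+* T :=
    ((asIso Φ₀) ≪≫ Scheme.ΓSpecIso (.of T)).commRingCatIsoToRingEquiv
  refine ⟨e, fun y => ?_⟩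
  have h5 : Φ₀.hom ((φ.app W).hom y) = (Scheme.ΓSpecIso (.of T)).inv.hom (y ⊗ₜ[A] (1 : E)) := by
    have := congrArg (fun k => k.hom y) key
    simpa [CommRingCat.hom_comp, CommRingCat.hom_ofHom] using this
  change (Scheme.ΓSpecIso (.of T)).hom.hom (Φ₀.hom ((φ.app W).hom y)) = _
  rw [h5, ← CommRingCat.comp_apply, Iso.inv_hom_id, CommRingCat.id_apply]

/-- **(REG) ∧ (Â) ⟹ (A): the principal affine case from the `g`-adically complete one**
(Temkin 2008, proof of Thm. 3.4.1, p. 18, the passage to `𝔛₀ = Spf Â` and back, with Lemma 3.1.4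
/ Cor. 3.1.5 for rig-regularity and Lemma 2.1.8 for blow-ups; here with the scheme
`Ŷ = Y ×_{Spec A} Spec Â` in place of the formal completion). See the module docstring for the
proof. [cite: Temkin2008, Thm. 3.4.1 (proof, p. 18), Lemma 3.1.4, Cor. 3.1.5]
[cite: Matsumura1987, Thm. 23.7] -/
theorem affine_of_complete
    (hREG : ∀ (A : Type u) [CommRing A], IsQuasiExcellentRing A → ∀ I : Ideal A,
      IsRegularHom A (AdicCompletion I A))
    (hcpl : ∀ (A : Type u) [CommRing A] [IsNoetherianRing A] (g : A),
      IsAdicComplete (Ideal.span {g}) A → IsReduced A → (∀ n : ℕ, n ≠ 0 → IsUnit (n : A)) →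
      (∀ P : PrimeSpectrum A, g ∉ P.asIdeal → P ∈ regularLocus A) →
      (∃ (k : Type u) (_ : Field k) (_ : Algebra k (A ⧸ Ideal.span {g})),
          Algebra.FiniteType k (A ⧸ Ideal.span {g})) →
      ∀ (Y : Scheme.{u}) (q : Y ⟶ Spec (.of A)) (Q : (Spec (.of A)).IdealSheafData),
        IsBlowup q Q → (∀ y ∈ Q.support, g ∈ y.asIdeal) → Scheme.AdmitsDesingularization Y)
    (A : Type u) [CommRing A] [IsDomain A] (hqe : IsQuasiExcellentRing A)
    (hunit : ∀ n : ℕ, n ≠ 0 → IsUnit (n : A)) (g : A)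
    (hreg : ∀ P : PrimeSpectrum A, g ∉ P.asIdeal → P ∈ regularLocus A)
    (hft : ∃ (k : Type u) (_ : Field k) (_ : Algebra k (A ⧸ Ideal.span {g})),
      Algebra.FiniteType k (A ⧸ Ideal.span {g}))
    (Y : Scheme.{u}) (q : Y ⟶ Spec (.of A)) (Q : (Spec (.of A)).IdealSheafData)
    (hq : IsBlowup q Q) (hQ : ∀ y ∈ Q.support, g ∈ y.asIdeal) :
    Scheme.AdmitsDesingularization Y := by
  haveI : IsNoetherianRing A := hqe.isNoetherianRing
  haveI : IsNoetherianRing (CommRingCat.of A) := ‹IsNoetherianRing A›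
  haveI : IsProper q := hq.isProper
  haveI : IsLocallyNoetherian Y := LocallyOfFiniteType.isLocallyNoetherian q
  haveI : CompactSpace Y := QuasiCompact.compactSpace_of_compactSpace q
  haveI : IsNoetherian Y := {}
  -- the completion
  set I : Ideal A := Ideal.span {g} with hI
  have hIfg : I.FG := ⟨{g}, by simp [hI]⟩
  let Ah : Type u := AdicCompletion I A
  haveI : IsNoetherianRing Ah := Stacks0316 A I
  let ι : A →+* Ah := algebraMap A Ah
  have hRegHom : IsRegularHom A Ah := hREG A hqe I
  haveI : Module.Flat A Ah := inferInstance
  let f : Spec (.of Ah) ⟶ Spec (.of A) := Spec.map (CommRingCat.ofHom ι)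
  haveI : Flat f := by
    refine (HasRingHomProperty.Spec_iff (P := @Flat)).mpr ?_
    change (algebraMap A Ah).Flat
    exact RingHom.flat_algebraMap_iff.mpr inferInstance
  -- the base-changed blow-up `Ŷ = Y ×_A Â → Spec Â`
  let Yh : Scheme.{u} := pullback q f
  let φ : Yh ⟶ Y := pullback.fst q f
  let qh : Yh ⟶ Spec (.of Ah) := pullback.snd q f
  have hqh : IsBlowup qh (Q.comap f) := hq.pullback_snd_of_flat f
  have hQh : ∀ y ∈ (Q.comap f).support, ι g ∈ y.asIdeal := by
    intro y hy
    rw [Scheme.IdealSheafData.support_comap] at hy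
    have hy' : f y ∈ Q.support := hy
    have := hQ _ hy'
    rw [Spec.map_apply] at this
    exact this
  -- hypotheses of the complete case for `(Â, ĝ)`
  have hcomplete : IsAdicComplete (Ideal.span {ι g}) Ah := by
    have h := AdicCompletion.isAdicComplete_self I (R := A) hIfg
    rwa [hI, Ideal.map_span, Set.image_singleton] at h
  have hred : IsReduced Ah := hRegHom.isReduced
  have hunith : ∀ n : ℕ, n ≠ 0 → IsUnit (n : Ah) := fun n hn => by
    simpa using (hunit n hn).map ι
  have hregh : ∀ P : PrimeSpectrum Ah, ι g ∉ P.asIdeal → P ∈ regularLocus Ah := by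
    intro P hP
    rw [mem_regularLocus]
    refine (hRegHom.isRegularLocalRing_localization_iff P.asIdeal).mpr ?_
    have := hreg ⟨P.asIdeal.under A, inferInstance⟩ fun h => hP (Ideal.mem_comap.mp h)
    rwa [mem_regularLocus] at this
  have hfth : ∃ (k : Type u) (_ : Field k) (_ : Algebra k (Ah ⧸ Ideal.span {ι g})),
      Algebra.FiniteType k (Ah ⧸ Ideal.span {ι g}) := by
    obtain ⟨k, _, _, hk⟩ := hft
    have hle : I ≤ (Ideal.span {ι g}).comap ι := by
      show Ideal.span {g} ≤ (Ideal.span {ι g}).comap ι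
      rw [Ideal.span_singleton_le_iff_mem, Ideal.mem_comap]
      exact Ideal.subset_span rfl
    let θ : A ⧸ I →+* Ah ⧸ Ideal.span {ι g} := Ideal.quotientMap _ ι hle
    have hθ : Function.Surjective θ := by
      intro z
      obtain ⟨x, rfl⟩ := Ideal.Quotient.mk_surjective z
      obtain ⟨a, ha⟩ := exists_sub_algebraMap_mem_map_pow I
        (quotientMap_pow_bijective_adicCompletion I hIfg) 1 x
      refine ⟨Ideal.Quotient.mk I a, ?_⟩
      rw [Ideal.quotientMap_mk, eq_comm, Ideal.Quotient.mk_eq_mk_iff_sub_mem]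
      have hmap : (I ^ 1).map ι = Ideal.span {ι g} := by
        rw [pow_one]
        show (Ideal.span {g}).map ι = Ideal.span {ι g}
        rw [Ideal.map_span, Set.image_singleton]
      rw [← hmap]
      exact ha
    letI : Algebra k (Ah ⧸ Ideal.span {ι g}) := (θ.comp (algebraMap k (A ⧸ I))).toAlgebra
    refine ⟨k, inferInstance, inferInstance, ?_⟩
    have h1 : (algebraMap k (A ⧸ I)).FiniteType := RingHom.finiteType_algebraMap.mpr hk
    exact (RingHom.FiniteType.of_surjective θ hθ).comp h1
  -- the desingularization of `Ŷ`
  obtain ⟨Y'', ψ, hdes⟩ := hcpl Ah (ι g) hcomplete hred hunith hregh hfth Yh qh (Q.comap f) hqh hQh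
  obtain ⟨Jh, hψ, hJh⟩ := hdes.exists_isBlowup
  have hY''reg := hdes.isRegular
  haveI : IsProper qh := hqh.isProper
  haveI : IsLocallyNoetherian Yh := LocallyOfFiniteType.isLocallyNoetherian qh
  haveI : CompactSpace Yh := QuasiCompact.compactSpace_of_compactSpace qh
  haveI : IsNoetherian Yh := {}
  -- (F12) the singular locus of `Ŷ` lies over `V(ĝ)`
  have hSingh : ∀ z : Yh, z ∉ Scheme.regularLocus Yh → ι g ∈ (qh z).asIdeal := by
    intro z hz
    by_contra hgz
    have hzQ : qh z ∉ ((Q.comap f).support : Set (Spec (.of Ah))) := fun h => hgz (hQh _ h)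
    haveI := hqh.isIso_compl
    apply hz
    refine (mem_regularLocus_iff_of_isIso_morphismRestrict qh
      ⟨((Q.comap f).support : Set (Spec (.of Ah)))ᶜ, (Q.comap f).support.isClosed.isOpen_compl⟩
      z hzQ).mpr ?_
    rw [Scheme.mem_regularLocus, isRegularLocalRing_stalk_Spec_iff]
    exact (mem_regularLocus _).mp (hregh (qh z) hgz)
  -- (F16) regularity ascends along `φ` at the points over `V(ĝ)`
  have hAscent : ∀ z : Yh, ι g ∈ (qh z).asIdeal → φ z ∈ Scheme.regularLocus Y →
      z ∈ Scheme.regularLocus Yh := by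
    intro z hgz hreg'
    obtain ⟨W, hW, hyW, -⟩ := exists_isAffineOpen_mem_and_subset (X := Y) (x := φ z) (U := ⊤)
      trivial
    let iW : Spec Γ(Y, W) ⟶ Y := hW.fromSpec
    let φW : CommRingCat.of A ⟶ Γ(Y, W) := Spec.preimage (iW ≫ q)
    letI : Algebra A Γ(Y, W) := φW.hom.toAlgebra
    have hi : iW ≫ q = Spec.map (CommRingCat.ofHom (algebraMap A Γ(Y, W))) := by
      rw [RingHom.algebraMap_toAlgebra, CommRingCat.ofHom_hom, Spec.map_preimage]
    haveI : Algebra.FiniteType A Γ(Y, W) := by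
      have h1 : LocallyOfFiniteType (Spec.map (CommRingCat.ofHom (algebraMap A Γ(Y, W)))) := by
        rw [← hi]; infer_instance
      exact RingHom.finiteType_algebraMap.mp
        ((HasRingHomProperty.Spec_iff (P := @LocallyOfFiniteType)).mp h1)
    haveI : IsNoetherianRing (Γ(Y, W) ⊗[A] Ah) := isNoetherianRing_tensor_of_finiteType Ah Γ(Y, W)
    let c := specTensorChart Ah q iW hi
    have hzrange : z ∈ Set.range c := by
      change z ∈ Set.range (specTensorChart Ah q iW hi)
      rw [range_specTensorChart, Set.mem_preimage, IsAffineOpen.range_fromSpec]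
      exact hyW
    obtain ⟨ζ, hζ⟩ := hzrange
    -- `1 ⊗ ĝ ∈ ζ`
    have hgζ : (1 : Γ(Y, W)) ⊗ₜ[A] ι g ∈ ζ.asIdeal := by
      have h1 : qh (c ζ) = qh z := by rw [hζ]
      rw [← Scheme.Hom.comp_apply] at h1
      change (specTensorChart Ah q iW hi ≫ pullback.snd q (specOfAlgebra A Ah)) ζ = qh z
        at h1
      rw [specTensorChart_snd, Spec.map_apply] at h1
      have h2 := congrArg PrimeSpectrum.asIdeal h1
      rw [PrimeSpectrum.comap_asIdeal] at h2
      have h3 : ι g ∈ (qh z).asIdeal := hgz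
      rw [← h2, Ideal.mem_comap] at h3
      exact h3
    -- `B_{ζ ∩ B}` is regular: it is the local ring of `Y` at `φ z`
    have hreg₀ : IsRegularLocalRing (Localization.AtPrime
        (ζ.asIdeal.comap (algebraMap Γ(Y, W) (Γ(Y, W) ⊗[A] Ah)))) := by
      let η : PrimeSpectrum Γ(Y, W) :=
        PrimeSpectrum.comap (algebraMap Γ(Y, W) (Γ(Y, W) ⊗[A] Ah)) ζ
      have hφz : φ z = iW η := by
        rw [← hζ, ← Scheme.Hom.comp_apply]
        change (specTensorChart Ah q iW hi ≫ pullback.fst q (specOfAlgebra A Ah)) ζ = _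
        rw [specTensorChart_fst, Scheme.Hom.comp_apply, Spec.map_apply]
        rfl
      have hη : IsRegularLocalRing ((Spec Γ(Y, W)).presheaf.stalk η) := by
        refine (isRegularLocalRing_stalk_iff_of_isOpenImmersion iW η).mp ?_
        rw [← hφz]
        exact (Scheme.mem_regularLocus _).mp hreg'
      exact (isRegularLocalRing_stalk_Spec_iff Γ(Y, W) η).mp hη
    have hsurj : ∀ w : Γ(Y, W) ⊗[A] Ah, ∃ b : Γ(Y, W),
        w - algebraMap Γ(Y, W) (Γ(Y, W) ⊗[A] Ah) b ∈
          (Ideal.span {algebraMap A Γ(Y, W) g}).map (algebraMap Γ(Y, W) (Γ(Y, W) ⊗[A] Ah)) := by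
      intro w
      obtain ⟨b, hb⟩ := exists_sub_tmul_one_mem_map_pow I hIfg 1 Γ(Y, W) w
      refine ⟨b, ?_⟩
      have hmap : (I ^ 1).map (algebraMap A (Γ(Y, W) ⊗[A] Ah)) =
          (Ideal.span {algebraMap A Γ(Y, W) g}).map (algebraMap Γ(Y, W) (Γ(Y, W) ⊗[A] Ah)) := by
        rw [pow_one, Ideal.map_span, Set.image_singleton, Ideal.map_span, Set.image_singleton,
          ← IsScalarTower.algebraMap_apply]
      rw [← hmap]
      exact hb
    have hζle : (Ideal.span {algebraMap A Γ(Y, W) g}).map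
        (algebraMap Γ(Y, W) (Γ(Y, W) ⊗[A] Ah)) ≤ ζ.asIdeal := by
      rw [Ideal.map_span, Set.image_singleton, Ideal.span_singleton_le_iff_mem,
        ← IsScalarTower.algebraMap_apply, Algebra.TensorProduct.algebraMap_apply,
        Algebra.algebraMap_eq_smul_one]
      -- `(g • 1) ⊗ 1 = 1 ⊗ ι g`
      have : (g • (1 : Γ(Y, W))) ⊗ₜ[A] (1 : Ah) = (1 : Γ(Y, W)) ⊗ₜ[A] ι g := by
        rw [TensorProduct.smul_tmul, Algebra.smul_def, mul_one]
      rw [this]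
      exact hgζ
    have hregζ : IsRegularLocalRing (Localization.AtPrime ζ.asIdeal) :=
      isRegularLocalRing_localization_of_forall_sub_mem (Ideal.span {algebraMap A Γ(Y, W) g}) hsurj
        ζ.asIdeal hζle hreg₀
    rw [← hζ]
    exact (Scheme.mem_regularLocus _).mpr ((isRegularLocalRing_stalk_iff_of_isOpenImmersion c ζ).mpr
      ((isRegularLocalRing_stalk_Spec_iff _ ζ).mpr hregζ))
  -- (F13) a power of the ideal of `g` lies in the centre `Ĵ`
  haveI : IsAffineHom f := inferInstance
  haveI : IsAffineHom φ := MorphismProperty.pullback_fst _ _ inferInstance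
  haveI : Flat φ := MorphismProperty.pullback_fst _ _ inferInstance
  let sg : Γ(Spec (.of A), ⊤) := (Scheme.ΓSpecIso (.of A)).inv g
  let G : Y.IdealSheafData := (Scheme.IdealSheafData.ofIdealTop (Ideal.span {sg})).comap q
  have hGsupp : ∀ y : Y, y ∈ (G.support : Set Y) ↔ g ∈ (q y).asIdeal := by
    intro y
    change y ∈ (((Scheme.IdealSheafData.ofIdealTop (Ideal.span {sg})).comap q).support : Set Y) ↔ _
    rw [Scheme.IdealSheafData.support_comap, TopologicalSpace.Closeds.coe_preimage, Set.mem_preimage,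
      Scheme.IdealSheafData.coe_support_ofIdealTop, Scheme.mem_zeroLocus_iff]
    have hsg : q y ∈ (Spec (.of A)).basicOpen sg ↔ g ∉ (q y).asIdeal := by
      change q y ∈ (Spec (.of A)).basicOpen ((Scheme.ΓSpecIso (.of A)).inv g) ↔ _
      rw [basicOpen_eq_of_affine]
      rfl
    constructor
    · intro h
      by_contra hg
      exact h sg (Ideal.subset_span rfl) (hsg.mpr hg)
    · intro hg s hs hys
      have hs' : s ∈ Ideal.span {sg} := hs
      rw [Ideal.mem_span_singleton'] at hs'
      obtain ⟨t, rfl⟩ := hs'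
      rw [Scheme.basicOpen_mul] at hys
      exact (hsg.mp hys.2) hg
  have hfq : ∀ z : Yh, g ∈ (q (φ z)).asIdeal ↔ ι g ∈ (qh z).asIdeal := by
    intro z
    have h1 : q (φ z) = f (qh z) := by
      have h0 : (pullback.fst q f ≫ q) z = (pullback.snd q f ≫ f) z := by rw [pullback.condition]
      rwa [Scheme.Hom.comp_apply, Scheme.Hom.comp_apply] at h0
    rw [h1]
    change g ∈ (Spec.map (CommRingCat.ofHom ι) (qh z)).asIdeal ↔ _
    rw [Spec.map_apply]
    rfl
  let H : Yh.IdealSheafData := G.comap φ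
  have hHsupp : ∀ z : Yh, z ∈ (H.support : Set Yh) ↔ ι g ∈ (qh z).asIdeal := by
    intro z
    change z ∈ ((G.comap φ).support : Set Yh) ↔ _
    rw [Scheme.IdealSheafData.support_comap, TopologicalSpace.Closeds.coe_preimage, Set.mem_preimage,
      hGsupp, hfq]
  have hJhH : (Jh.support : Set Yh) ⊆ H.support := fun z hz =>
    (hHsupp z).mpr (hSingh z (hJh hz))
  obtain ⟨N, hN⟩ := exists_pow_succ_le_of_support_subset hJhH
  -- the descended centre
  let J : Y.IdealSheafData := Jh.map φ
  have hJcomap : J.comap φ = Jh := by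
    -- the affine opens `φ⁻¹(W)`, `W ⊆ Y` affine, cover `Ŷ`
    let V : Y.affineOpens → Yh.affineOpens := fun W => ⟨φ ⁻¹ᵁ (W : Y.Opens), W.2.preimage φ⟩
    have hV : ⨆ W, (V W : Yh.Opens) = ⊤ := by
      change ⨆ W : Y.affineOpens, φ ⁻¹ᵁ (W : Y.Opens) = ⊤
      rw [← Scheme.Hom.preimage_iSup, iSup_affineOpens_eq_top]
      rfl
    refine Scheme.IdealSheafData.ext_of_iSup_eq_top V hV fun W => ?_
    have hW : IsAffineOpen (W : Y.Opens) := W.2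
    -- `Γ(Y, W)` as an `A`-algebra through `q`, and the chart identification
    letI alg : Algebra A Γ(Y, W) :=
      ((q.appLE ⊤ W le_top).hom.comp (Scheme.ΓSpecIso (.of A)).inv.hom).toAlgebra
    have hi : hW.fromSpec ≫ q = Spec.map (CommRingCat.ofHom (algebraMap A Γ(Y, W))) := by
      rw [fromSpec_comp_eq_specMap q hW]
      rfl
    obtain ⟨eT, heT⟩ := exists_ringEquiv_sections_pullback_fst Ah q hW hi
    set θ : Γ(Y, W) →+* Γ(Yh, φ ⁻¹ᵁ W) := (φ.app W).hom with hθ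
    have heT' : ∀ y : Γ(Y, W), eT (θ y) = y ⊗ₜ[A] (1 : Ah) := heT
    set gB : Γ(Y, W) := algebraMap A Γ(Y, W) g with hgB
    set 𝔟₀ : Ideal Γ(Y, W) := Ideal.span {gB ^ (N + 1)} with h𝔟₀
    -- every section over `φ⁻¹ W` is `≡ θ b` modulo `gᴺ⁺¹`
    have hsurjθ : ∀ w : Γ(Yh, φ ⁻¹ᵁ W), ∃ b : Γ(Y, W), w - θ b ∈ 𝔟₀.map θ := by
      intro w
      obtain ⟨b, hb⟩ := exists_sub_tmul_one_mem_map_pow I hIfg (N + 1) Γ(Y, W) (eT w)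
      refine ⟨b, ?_⟩
      have hmap : (I ^ (N + 1)).map (algebraMap A (Γ(Y, W) ⊗[A] Ah)) =
          (𝔟₀.map θ).map eT.toRingHom := by
        rw [h𝔟₀, Ideal.map_span, Set.image_singleton, Ideal.map_span, Set.image_singleton,
          map_pow, RingEquiv.toRingHom_eq_coe, RingHom.coe_coe, map_pow, heT', Ideal.map_pow,
          Ideal.map_span, Set.image_singleton]
        show Ideal.span {algebraMap A (Γ(Y, W) ⊗[A] Ah) g} ^ (N + 1) = _
        rw [Algebra.TensorProduct.algebraMap_apply, Ideal.span_singleton_pow]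
      have hmem : eT (w - θ b) ∈ (𝔟₀.map θ).map eT.toRingHom := by
        rw [map_sub, heT', ← hmap]
        exact hb
      rw [RingEquiv.toRingHom_eq_coe, Ideal.map_comap_of_equiv, Ideal.mem_comap] at hmem
      simpa using hmem
    -- `gᴺ⁺¹ Γ(Ŷ, φ⁻¹W) ⊆ Ĵ(φ⁻¹W)`
    have hgBG : gB ∈ G.ideal W := by
      rw [ideal_comap_of_le q _ ⟨⊤, isAffineOpen_top _⟩ W le_top, ideal_ofIdealTop_top]
      exact Ideal.mem_map_of_mem _ (Ideal.subset_span rfl)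
    have hle𝔟 : 𝔟₀.map θ ≤ Jh.ideal (V W) := by
      have h1 : 𝔟₀ ≤ (G ^ (N + 1)).ideal W := by
        rw [h𝔟₀, Ideal.span_singleton_le_iff_mem, Scheme.IdealSheafData.ideal_pow, Pi.pow_apply]
        exact Ideal.pow_mem_pow hgBG _
      have h2 : ((G ^ (N + 1)).ideal W).map θ = (H ^ (N + 1)).ideal (V W) := by
        rw [hθ, ← Scheme.Hom.appLE_eq_app, ← ideal_comap_of_le φ (G ^ (N + 1)) W (V W) le_rfl,
          comap_pow]
      calc 𝔟₀.map θ ≤ ((G ^ (N + 1)).ideal W).map θ := Ideal.map_mono h1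
        _ = (H ^ (N + 1)).ideal (V W) := h2
        _ ≤ Jh.ideal (V W) := hN (V W)
    -- conclusion on the chart
    have hL : (J.comap φ).ideal (V W) = ((Jh.ideal (V W)).comap θ).map θ := by
      rw [ideal_comap_of_le φ J W (V W) le_rfl, Scheme.Hom.appLE_eq_app]
      change ((Jh.map φ).ideal W).map θ = _
      rw [Scheme.IdealSheafData.ideal_map_of_isAffineHom]
    rw [hL]
    exact Ideal.map_comap_eq_of_forall_sub_mem θ 𝔟₀ hsurjθ hle𝔟
  -- its support lies in the singular locus of `Y`, and over `V(g)`
  have hk : Scheme.IsQuasiExcellent (Spec (.of A)) :=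
    Scheme.isQuasiExcellent_of_locallyOfFiniteType_of_isQuasiExcellentRing Stacks07QU_holds hqe
      (𝟙 (Spec (.of A)))
  have hRegc : IsClosed (Scheme.regularLocus Y)ᶜ := isClosed_compl_regularLocus_of_locallyOfFiniteType q hk
  have hJsupp' : φ '' (Jh.support : Set Yh) ⊆ (Scheme.regularLocus Y)ᶜ := by
    rintro _ ⟨z, hz, rfl⟩ hreg'
    exact hJh hz (hAscent z (hSingh z (hJh hz)) hreg')
  have hJsupp : (J.support : Set Y) ⊆ (Scheme.regularLocus Y)ᶜ := by
    change ((Jh.map φ).support : Set Y) ⊆ _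
    rw [Scheme.IdealSheafData.support_map, TopologicalSpace.Closeds.coe_closure]
    exact hRegc.closure_subset_iff.mpr hJsupp'
  have hJG : (J.support : Set Y) ⊆ G.support := by
    change ((Jh.map φ).support : Set Y) ⊆ _
    rw [Scheme.IdealSheafData.support_map, TopologicalSpace.Closeds.coe_closure]
    refine G.support.isClosed.closure_subset_iff.mpr ?_
    rintro _ ⟨z, hz, rfl⟩
    exact (hGsupp _).mpr ((hfq z).mpr (hSingh z (hJh hz)))
  -- blow up `Y` along `J`; its base change to `Â` is `Y''`
  obtain ⟨Y', π', hπ'⟩ := exists_isBlowup Y J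
  haveI : IsProper π' := hπ'.isProper
  haveI : IsLocallyNoetherian Y' := LocallyOfFiniteType.isLocallyNoetherian π'
  let Yh' : Scheme.{u} := pullback (π' ≫ q) f
  let φ' : Yh' ⟶ Y' := pullback.fst (π' ≫ q) f
  haveI : Flat φ' := MorphismProperty.pullback_fst _ _ inferInstance
  have tsq : IsPullback φ qh q f := IsPullback.of_hasPullback q f
  have bigsq : IsPullback φ' (pullback.snd (π' ≫ q) f) (π' ≫ q) f := IsPullback.of_hasPullback _ _
  have sq := IsPullback.of_bot' bigsq tsq
  have hρ : IsBlowup (tsq.lift (φ' ≫ π') (pullback.snd (π' ≫ q) f)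
      (by rw [Category.assoc, bigsq.w])) Jh := by
    have := hπ'.of_isPullback_of_flat sq
    rwa [hJcomap] at this
  obtain ⟨e, -, -⟩ := hρ.unique hψ
  have hYh'reg : Scheme.IsRegular Yh' := fun z =>
    (mem_regularLocus_iff_of_flat_of_isPreimmersion e.hom z).mpr (hY''reg _) |> fun h =>
      (Scheme.mem_regularLocus _).mp h
  -- `Y'` is regular
  have hY'reg : Scheme.IsRegular Y' := by
    intro y₁
    by_cases hg₁ : g ∈ (q (π' y₁)).asIdeal
    · -- over `V(g)`: a point of `Ŷ'` above `y₁`, and flat descent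
      -- a prime of `Â` over `𝔭 = q (π' y₁) ∋ g`
      set 𝔭 : Ideal A := (q (π' y₁)).asIdeal with h𝔭
      haveI : 𝔭.IsPrime := (q (π' y₁)).isPrime
      have hI𝔭 : I ≤ 𝔭 := by
        show Ideal.span {g} ≤ 𝔭
        rw [Ideal.span_singleton_le_iff_mem]; exact hg₁
      haveI : (𝔭.map (Ideal.Quotient.mk I)).IsPrime :=
        Ideal.map_isPrime_of_surjective Ideal.Quotient.mk_surjective (by rwa [Ideal.mk_ker])
      let P' : PrimeSpectrum Ah :=
        ⟨(𝔭.map (Ideal.Quotient.mk I)).comap (AdicCompletion.evalOneₐ I).toRingHom, inferInstance⟩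
      have hP' : f P' = q (π' y₁) := by
        apply PrimeSpectrum.ext
        change ((Spec.map (CommRingCat.ofHom ι)) P').asIdeal = 𝔭
        rw [Spec.map_apply, PrimeSpectrum.comap_asIdeal]
        change Ideal.comap ι ((𝔭.map (Ideal.Quotient.mk I)).comap (AdicCompletion.evalOneₐ I).toRingHom) = 𝔭
        rw [Ideal.comap_comap, AdicCompletion.evalOneₐ_comp_algebraMap_eq_mk,
          Ideal.comap_map_of_surjective _ Ideal.Quotient.mk_surjective, ← RingHom.ker_eq_comap_bot,
          Ideal.mk_ker, sup_eq_left.mpr hI𝔭]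
      have hcond : (π' ≫ q) y₁ = f P' := by rw [Scheme.Hom.comp_apply, hP']
      obtain ⟨z₁, hz₁, -⟩ :=
        Scheme.Pullback.exists_preimage_pullback (f := π' ≫ q) (g := f) y₁ P' hcond
      haveI : IsRegularLocalRing (Yh'.presheaf.stalk z₁) := hYh'reg z₁
      subst hz₁
      exact IsRegularLocalRing.of_flat_ringHom (φ'.stalkMap z₁).hom (Flat.stalkMap φ' z₁)
    · -- off `V(g)`: `π'` and `q` are isomorphisms near `y₁`, and `A` is regular there
      have h1 : π' y₁ ∉ (J.support : Set Y) := fun h => hg₁ ((hGsupp _).mp (hJG h))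
      haveI := hπ'.isIso_compl
      refine (Scheme.mem_regularLocus _).mp ((mem_regularLocus_iff_of_isIso_morphismRestrict π'
        ⟨(J.support : Set Y)ᶜ, J.support.isClosed.isOpen_compl⟩ y₁ h1).mpr ?_)
      have h2 : q (π' y₁) ∉ (Q.support : Set (Spec (.of A))) := fun h => hg₁ (hQ _ h)
      haveI := hq.isIso_compl
      refine (mem_regularLocus_iff_of_isIso_morphismRestrict q
        ⟨(Q.support : Set (Spec (.of A)))ᶜ, Q.support.isClosed.isOpen_compl⟩ (π' y₁) h2).mpr ?_
      rw [Scheme.mem_regularLocus, isRegularLocalRing_stalk_Spec_iff]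
      exact (mem_regularLocus _).mp (hreg (q (π' y₁)) hg₁)
  exact ⟨Y', π', ⟨J, hπ', hJsupp⟩, hY'reg⟩


/-- **(REG) ∧ (Â) ⟹ `Hironaka1964_local`**: resolution of singularities over every local
quasi-excellent ring of residue characteristic zero (Hironaka 1964, Main Theorem I, as read by
Temkin 2008) follows from (REG) — `A → Â_I` is regular for quasi-excellent `A`
(EGA IV₂ 7.8.3 (v)) — and the `g`-adically complete principal affine case (Â), the input of the
algebraization half of Temkin's local step (Prop. 3.2.3, Prop. 3.3.1, resolution of varieties in
characteristic zero); through (L), (C), (C₀), (A) (`hironaka1964_local_of_affine`) and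
`affine_of_complete`. [cite: Temkin2008, Thm. 3.4.3, Cor. 3.4.2, Thm. 3.4.1]
[cite: Hironaka1964, Main Theorem I] -/
theorem hironaka1964_local_of_complete
    (hREG : ∀ (A : Type u) [CommRing A], IsQuasiExcellentRing A → ∀ I : Ideal A,
      IsRegularHom A (AdicCompletion I A))
    (hcpl : ∀ (A : Type u) [CommRing A] [IsNoetherianRing A] (g : A),
      IsAdicComplete (Ideal.span {g}) A → IsReduced A → (∀ n : ℕ, n ≠ 0 → IsUnit (n : A)) →
      (∀ P : PrimeSpectrum A, g ∉ P.asIdeal → P ∈ regularLocus A) →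
      (∃ (k : Type u) (_ : Field k) (_ : Algebra k (A ⧸ Ideal.span {g})),
          Algebra.FiniteType k (A ⧸ Ideal.span {g})) →
      ∀ (Y : Scheme.{u}) (q : Y ⟶ Spec (.of A)) (Q : (Spec (.of A)).IdealSheafData),
        IsBlowup q Q → (∀ y ∈ Q.support, g ∈ y.asIdeal) → Scheme.AdmitsDesingularization Y) :
    Hironaka1964_local.{u} :=
  hironaka1964_local_of_affine fun A _ _ hqe hunit g hreg hft Y q Q hq hQ =>
    affine_of_complete hREG hcpl A hqe hunit g hreg hft Y q Q hq hQ

end Literature.AlgebraicGeometry.Resolution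

end
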